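import Mathlib.Analysis.SpecialFunctions.Pow.Real
import Mathlib.Analysis.Complex.Basic
import Mathlib.Analysis.Calculus.FDeriv.Basic
import Mathlib.Topology.MetricSpace.Pseudo.Defs

/-!
# BalabanUVNodes ∕ node N22 = NE9 — THE W1 OBJECT ON THE RELATIVE-DISC CENTRED ROAD (RE-TYPING M1′), MODULE R3: THE SECTOR — an honest inhabitant of the domain-family clauses of
# R1a ∕ R1b ∕ R2 (open, contains the window points and the RELATIVE closed discs `closedBall (t : ℂ) (cA·t)`, does NOT contain zero coupling, lies in the right half-plane)

Cell `pub-ymgap`, HUMAN RULING D-0062 (Track A), R134 ACCELERATION re-seat `pub-ymgap-dag-n22-c` (strategy s1), generation 6, file R3 of the re-typed line.  THEOREMS ONLY, Mathlib only.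
`--supports` K3⁗ `SpineGivenEndpointR13Sep` (stmt-QuantumFields-20292) as a helper.

WHY.  The re-typed leaves (R2 `…N22W1RelCentredTermDatum214`, R2b `…Keyed`) display a domain family `D : ℕ → Set ℂ` with `IsOpen (D i)`, `↑t ∈ D i` and `closedBall (t : ℂ) (cA·t) ⊆ D i`
for `t ∈ ]0, γ]`, `0 < cA < 1` — the home of the last-coupling schemas (S-last-T′) ∕ (S-vertex-T′).  THIS FILE exhibits the intended inhabitant, the SECTOR of aperture `c`,
`S := {z | ∃ t ∈ ]0, γ], dist z t < c·t}` (for any `cA < c`), and records the two facts that separate the re-typed road from the located one: `0 ∉ S` when `c ≤ 1` (no analyticity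
at zero coupling is asked — contrast `…N22W1StripLastTermwiseVertexRider.zero_mem_of_lastDiscs` for the uniform-disc clause) and `S ⊆ {Re > 0}` when `c ≤ 1` (the window side of the
coupling plane; the possibility-1 continuation of [I] (2.10) p.267 lives on `{|arg z| < π∕4}`, which contains the sector for `c ≤ 1∕2` — §2).

WHAT.  §1 `isOpen_relSector`, `ofReal_mem_relSector`, `closedBall_subset_relSector` (`cA < c`), `zero_not_mem_relSector` (`c ≤ 1`), `re_pos_of_mem_relSector` (`c ≤ 1`);
§2 `abs_im_lt_re_of_mem_relSector` (`c ≤ 1∕2` ⇒ `|Im z| < Re z`, i.e. `Re z² > 0`: inside the quarter-plane sector), `relSector_domainClauses` (the three displayed clauses at once, for the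
constant family `D := fun _ ↦ S`).  §3 (v1.1) `forall_relSector_of_closedBalls`, `differentiableOn_relSector_of_closedBalls` — from a producer's CLOSED relative discs
`closedBall (t:ℂ)(c·t)`, `t ∈ ]0,γ]` (dag-n10-c g6 `B13Term214WindowDilated` §3) to the consumer's OPEN sector of the same aperture.

HONEST FRAMING.  Elementary plane geometry; count-neutral; nothing of Bałaban's asserted; it shows the DOMAIN clauses of R1a∕R1b∕R2 are met by a possibility-1-faithful region, not that any
schema is.  0 `sorry`, 0 `def`, standard axioms.

References (TYPES only): [I] = [Balaban1987RG1] §1 p. 263 (the window `]0, γ]`), (2.9)–(2.10) pp. 266–267.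
-/

noncomputable section

namespace YMDAG.N22.W1

open Set Metric

/-! ## §1 The relative sector about the window -/

/-- **THE RELATIVE SECTOR IS OPEN**: `{z | ∃ t ∈ ]0,γ], dist z t < c·t}` is a union of open balls. [folklore] -/
theorem isOpen_relSector (γ c : ℝ) : IsOpen {z : ℂ | ∃ t ∈ Ioc (0 : ℝ) γ, dist z (t : ℂ) < c * t} := by
  have : {z : ℂ | ∃ t ∈ Ioc (0 : ℝ) γ, dist z (t : ℂ) < c * t} = ⋃ t ∈ Ioc (0 : ℝ) γ, ball (t : ℂ) (c * t) := by
    ext z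
    simp only [mem_setOf_eq, mem_iUnion, mem_ball, exists_prop]
  rw [this]
  exact isOpen_biUnion fun _ _ => isOpen_ball

/-- **THE WINDOW POINTS LIE IN THE SECTOR** (`0 < c`). [cite: Balaban1987RG1, §1 p.263 (the window)] -/
theorem ofReal_mem_relSector {γ c : ℝ} (hc : 0 < c) {t : ℝ} (ht : t ∈ Ioc (0 : ℝ) γ) :
    ((t : ℝ) : ℂ) ∈ {z : ℂ | ∃ t ∈ Ioc (0 : ℝ) γ, dist z (t : ℂ) < c * t} :=
  ⟨t, ht, by rw [dist_self]; exact mul_pos hc ht.1⟩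

/-- **THE RELATIVE CLOSED DISCS OF A SMALLER APERTURE LIE IN THE SECTOR**: `closedBall (t : ℂ) (cA·t) ⊆ S` for `cA < c`, `t ∈ ]0,γ]`. [folklore] -/
theorem closedBall_subset_relSector {γ c cA : ℝ} (hcA : cA < c) {t : ℝ} (ht : t ∈ Ioc (0 : ℝ) γ) :
    closedBall (t : ℂ) (cA * t) ⊆ {z : ℂ | ∃ t ∈ Ioc (0 : ℝ) γ, dist z (t : ℂ) < c * t} := fun _ hz =>
  ⟨t, ht, lt_of_le_of_lt (mem_closedBall.mp hz) (mul_lt_mul_of_pos_right hcA ht.1)⟩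

/-- **EVERY POINT OF THE SECTOR HAS POSITIVE REAL PART** (`c ≤ 1`): `Re z > t − c·t ≥ 0`. [folklore] -/
theorem re_pos_of_mem_relSector {γ c : ℝ} (hc1 : c ≤ 1) {z : ℂ} (hz : z ∈ {z : ℂ | ∃ t ∈ Ioc (0 : ℝ) γ, dist z (t : ℂ) < c * t}) : 0 < z.re := by
  obtain ⟨t, ht, hd⟩ := hz
  have h1 : |z.re - t| < c * t := by
    have h := Complex.abs_re_le_norm (z - (t : ℂ))
    rw [Complex.sub_re, Complex.ofReal_re] at h
    rw [dist_eq_norm] at hd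
    exact lt_of_le_of_lt h hd
  have h2 : c * t ≤ t := by nlinarith [ht.1]
  have h3 := (abs_lt.mp h1).1
  linarith

/-- **ZERO COUPLING IS NOT IN THE SECTOR** (`c ≤ 1`) — the re-typed road asks no analyticity at `g = 0` (contrast the uniform-disc clause of 22′–25′:
`…N22W1StripLastTermwiseVertexRider.zero_mem_of_lastDiscs`). [cite: Balaban1987RG1, (2.9) p.266 (possibility 1 versus the variant)] -/
theorem zero_not_mem_relSector {γ c : ℝ} (hc1 : c ≤ 1) : (0 : ℂ) ∉ {z : ℂ | ∃ t ∈ Ioc (0 : ℝ) γ, dist z (t : ℂ) < c * t} := fun h => by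
  have := re_pos_of_mem_relSector hc1 h
  simp at this

/-! ## §2 The sector of aperture `≤ ½` lies in the quarter-plane `|Im z| < Re z` (so `Re z² > 0`), and the three displayed domain clauses at once -/

/-- **APERTURE `c ≤ ½` ⇒ `|Im z| < Re z`** (`Re z² = Re² − Im² > 0`: the sector sits inside `{|arg z| < π∕4}`, the half-plane `Re (1∕z²) > 0` of the temperature `τ = 1∕g²` where the
possibility-1 continuation of [I] (2.10) lives). [cite: Balaban1987RG1, (2.10) p.267] -/
theorem abs_im_lt_re_of_mem_relSector {γ c : ℝ} (hc : c ≤ 1 / 2) {z : ℂ} (hz : z ∈ {z : ℂ | ∃ t ∈ Ioc (0 : ℝ) γ, dist z (t : ℂ) < c * t}) : |z.im| < z.re := by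
  obtain ⟨t, ht, hd⟩ := hz
  rw [dist_eq_norm] at hd
  have hre : |z.re - t| < c * t := by
    have h := Complex.abs_re_le_norm (z - (t : ℂ))
    rw [Complex.sub_re, Complex.ofReal_re] at h
    exact lt_of_le_of_lt h hd
  have him : |z.im| < c * t := by
    have h := Complex.abs_im_le_norm (z - (t : ℂ))
    rw [Complex.sub_im, Complex.ofReal_im, sub_zero] at h
    exact lt_of_le_of_lt h hd
  have h3 := (abs_lt.mp hre).1
  nlinarith [ht.1]

/-- **THE THREE DISPLAYED DOMAIN CLAUSES OF R1a ∕ R1b ∕ R2 AT THE CONSTANT SECTOR FAMILY** `D := fun _ ↦ S` (`0 < cA < c`): every member open, the window points inside, the relative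
closed discs of aperture `cA` inside. [cite: Balaban1987RG1, §1 p.263 and (2.9)-(2.10) pp.266-267] -/
theorem relSector_domainClauses {γ c cA : ℝ} (hcA0 : 0 < cA) (hcA : cA < c) :
    (∀ _i : ℕ, IsOpen {z : ℂ | ∃ t ∈ Ioc (0 : ℝ) γ, dist z (t : ℂ) < c * t}) ∧
    (∀ (_i : ℕ), ∀ t ∈ Ioc (0 : ℝ) γ, ((t : ℝ) : ℂ) ∈ {z : ℂ | ∃ t ∈ Ioc (0 : ℝ) γ, dist z (t : ℂ) < c * t}) ∧
    (∀ (_i : ℕ), ∀ t ∈ Ioc (0 : ℝ) γ, closedBall (t : ℂ) (cA * t) ⊆ {z : ℂ | ∃ t ∈ Ioc (0 : ℝ) γ, dist z (t : ℂ) < c * t}) :=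
  ⟨fun _ => isOpen_relSector γ c, fun _ _ ht => ofReal_mem_relSector (hcA0.trans hcA) ht, fun _ _ ht => closedBall_subset_relSector hcA ht⟩

/-! ## §3 (v1.1) From the producer's CLOSED RELATIVE DISCS to the consumer's OPEN SECTOR — the junction with a per-window-point producer (dag-n10-c g6
`B13Term214WindowDilated` §3: holomorphy and bounds on every `closedBall (t:ℂ)(c·t)`, `t ∈ ]0,γ]`) -/

/-- **A PROPERTY HOLDING ON EVERY CLOSED RELATIVE DISC HOLDS ON THE SECTOR OF THE SAME APERTURE** (`ball ⊆ closedBall`). [folklore] -/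
theorem forall_relSector_of_closedBalls {γ c : ℝ} {P : ℂ → Prop} (h : ∀ t ∈ Ioc (0 : ℝ) γ, ∀ z ∈ closedBall (t : ℂ) (c * t), P z) :
    ∀ z ∈ {z : ℂ | ∃ t ∈ Ioc (0 : ℝ) γ, dist z (t : ℂ) < c * t}, P z := fun z hz => by
  obtain ⟨t, ht, hd⟩ := hz
  exact h t ht z (mem_closedBall.mpr hd.le)

/-- **HOLOMORPHY ON EVERY CLOSED RELATIVE DISC GIVES HOLOMORPHY ON THE OPEN SECTOR OF THE SAME APERTURE**: if `f` is `DifferentiableOn ℂ` on each `closedBall (t:ℂ)(c·t)`,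
`t ∈ ]0,γ]`, then `f` is `DifferentiableOn ℂ` on `{z | ∃ t ∈ ]0,γ], dist z t < c·t}` (every point of the sector is INTERIOR to one of the closed discs) — turns a base-point-wise
producer (holomorphy of ONE base-point-free continued family on each closed relative disc) into the consumer's (S-last-T′) clause on the domain family `D := fun _ ↦ sector`
of `relSector_domainClauses` (any smaller aperture `cA < c` for the displayed closed discs). [folklore] -/
theorem differentiableOn_relSector_of_closedBalls {γ c : ℝ} {f : ℂ → ℂ} (hf : ∀ t ∈ Ioc (0 : ℝ) γ, DifferentiableOn ℂ f (closedBall (t : ℂ) (c * t))) :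
    DifferentiableOn ℂ f {z : ℂ | ∃ t ∈ Ioc (0 : ℝ) γ, dist z (t : ℂ) < c * t} := fun z hz => by
  obtain ⟨t, ht, hd⟩ := hz
  have hn : closedBall (t : ℂ) (c * t) ∈ nhds z :=
    Filter.mem_of_superset (isOpen_ball.mem_nhds (mem_ball.mpr hd)) ball_subset_closedBall
  exact ((hf t ht).differentiableAt hn).differentiableWithinAt

end YMDAG.N22.W1

end
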